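import Literature.NumberTheory.EllipticCurves.HalfIntegralWeightForms
import Mathlib.NumberTheory.Padics.PadicNumbers
import HarnessLib

/-!
# Raum 2023, §2: Ramanujan-type congruences of half-integral weight modular forms live on square classes,
# and on RAMIFIED square classes they come in pairs (Propositions 2.1 and 2.3)

Topic `Literature/NumberTheory/ModularForms` (one file for §2 of the source, D-0064). STATEMENT-ONLY named facts (no proof
is claimed), in the tree's own vocabulary of modular forms of half-integral weight: Shimura's space `M_{k/2}(N, χ)` is
`Literature.NumberTheory.EllipticCurves.ModularForms.halfIntModularForms k N χ` (`HalfIntegralWeightForms.lean`: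
holomorphic on `ℍ`, theta-automorphic `f(γz) θ(z)^k = χ(d) θ(γz)^k f(z)` on `Γ₀(N)`, Shimura's cusp condition at every
cusp; `k` odd, `4 ∣ N`), and its `q`-expansion coefficients are `qCoeffs` (Mathlib's period-`1` `qExpansion 1`). A
RAMANUJAN-TYPE CONGRUENCE of `f = ∑ c(n) qⁿ` modulo a prime `ℓ` on the arithmetic progression `Mℤ + β` is the statement
`c(n) ≡ 0 (mod ℓ)` for every `n ≡ β (mod M)`; for RATIONAL `ℓ`-integral coefficients `c(n) = a n ∈ ℚ` this reads
`‖(a n : ℚ_[ℓ])‖ ≤ ℓ⁻¹`, and `ℓ`-integrality reads `‖(a n : ℚ_[ℓ])‖ ≤ 1`.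

M. Raum, *Relations among Ramanujan-type congruences II: Ramanujan-type congruences in half-integral weights*, Forum
Math. 35 (2023) 615–646 (= arXiv:2105.13170; held as `paper:arxiv-2105.13170`, statements read on arXiv pp. 17–23):

* **Proposition 2.1** (arXiv p. 17): a Ramanujan-type congruence of a weakly holomorphic modular form of half-integral
  weight (theta- or eta-character times a Dirichlet character `χ`, coefficients in the `ℓ`-integers `O_{K,ℓ}` of a number
  field) on `Mℤ + β` implies the same congruence on `Mℤ + u²β` for every `u` prime to `M N_χ` (`N_χ` the level of the kernel
  of the character) — congruences live on SQUARE CLASSES modulo `M`.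
* **Proposition 2.3** (arXiv p. 20, «Ramanujan-type congruences with gap»): if moreover `ℓ ∤ 2`, `p ∣ M` is a prime with
  `gcd(p, ℓN) = 1`, the `p`-part of `M` is EXACTLY `p²` and `p` divides `β` EXACTLY, then the congruence on `Mℤ + β` implies
  the congruence on `Mℤ + β'` for EVERY `β'` exactly divisible by `p` with `β' ≡ β (mod M/p²)` — i.e. on BOTH ramified
  square classes `{p·u : (u|p) = ±1}` at once. The proof (arXiv pp. 21–23) lets the lower unipotent `γ ≡ (1 0; 1 1) (mod p²)`
  of `Γ₀(N)` act on the twisted translate sum `T_M(f, β)`, projects to the `β'`-eigenspace of the translation `T`, and finds a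
  Kloosterman sum `K₂(ψ, a) = Σ_{x₁x₂ ≡ a (p)} ψ(x₁ + x₂)` as the coefficient, which is `≢ 0 (mod ℓ)` for every odd `ℓ`
  (Lemma 2.4, arXiv pp. 20–21); the `ℓ`-kernel is stable under `Γ̃₀(N)` by the `q`-expansion principle (Cor. 1.3 there).
  There is NO exception at primes with `ℓ ∣ p + 1` or `ℓ ∣ p − 1`.

Formalisation: both facts are stated in the SPECIAL CASE the tree needs — holomorphic forms (`halfIntModularForms`, so only
indices `n ≥ 0` occur and «`∀ n ∈ ℤ`» becomes «every `n : ℕ` in the residue class»), theta-character (`k` odd, `4 ∣ N`),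
rational coefficients (`K = ℚ`, `ℓ` a rational prime: `qCoeffs f n = a n` with `a : ℕ → ℚ`), and in Prop. 2.1 the
coprimality `gcd(u, M·N) = 1` (which implies Raum's `gcd(u, M·N_χ) = 1` because `N_χ ∣ N` when `4 ∣ N`).
-- TODO(general form): weakly holomorphic forms, eta-character `χ_η^r`, coefficients in the `ℓ`-integers of a number field,
-- `β ∈ N_χ⁻¹ℤ` in Prop. 2.1, and the remaining statements of §2 (Lemma 2.2: square-class cuts are modular of level
-- `M² lcm(N,4)`; Lemma 2.4: `K₂(ψ, a) ≢ 0 (mod ℓ)`).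

USED BY: the line `eisenstein-resource-bdp-line` on crux `PrintCFram.BottomClassIndexLawFiveLe` (BSD cell bsd-print-cfram):
applied to Cohen's `H_k ∈ M_{(2k+1)/2}(4, χ₀)` (`Cohen1975.thm31_cohenSeries_mem_halfIntModularForms`), Prop. 2.3 is the
«flipped rung» at EVERY odd prime `q ∣ m` — including the level-raising primes `q ≡ −1 (mod 4p)` where the Fricke/cusp
reading is blind — so the line's analytic residue closes by citation. Nothing here is specific to that application.

## References

* [Raum2023RamanujanTypeII] M. Raum, *Relations among Ramanujan-type congruences II*, Forum Math. 35 (2023) 615–646,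
  Prop. 2.1, Prop. 2.3, Lemma 2.4 (doi:10.1515/forum-2022-0041; arXiv:2105.13170 pp. 17–23, held).
* [Shimura1973HalfIntegral] G. Shimura, *On modular forms of half integral weight*, Ann. of Math. 97 (1973) 440–481, §1
  (the spaces `M_k(N, χ)`).
-/

noncomputable section

open UpperHalfPlane

namespace Literature.NumberTheory.ModularForms.Raum2023

open Literature.NumberTheory.EllipticCurves.ModularForms

/-- **Raum 2023, Proposition 2.1 (square-class invariance of Ramanujan-type congruences; special case: holomorphic,
theta-character, rational `ℓ`-integral coefficients).** Let `ℓ` be a prime, `f ∈ M_{k/2}(N, χ)` (`k` odd, `4 ∣ N`) with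
rational `q`-expansion coefficients `a n`, all `ℓ`-integral. If `a n ≡ 0 (mod ℓ)` for every `n ≡ β (mod M)`, then for every
`u` with `gcd(u, M·N) = 1` also `a n ≡ 0 (mod ℓ)` for every `n ≡ u²β (mod M)`. Verbatim (arXiv p. 17): «Assume that `f`
satisfies the Ramanujan-type congruence `∀ n ∈ ℤ: c(f; Mn + β) ≡ 0 (mod ℓ)` … Then for all `β' = u²β`, `u ∈ ℤ`, with
`gcd(u, M N_χ) = 1`, we have the Ramanujan-type congruence `∀ n ∈ ℤ: c(f; Mn + β') ≡ 0 (mod ℓ)`.»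
[cite: Raum2023RamanujanTypeII, Prop. 2.1 (arXiv:2105.13170 p. 17)] -/
def prop21_ramanujanCongruence_squareClass : Prop :=
  ∀ (ℓ : ℕ) [Fact ℓ.Prime] (k N : ℕ) (χ : DirichletCharacter ℂ N) (f : ℍ → ℂ),
    Odd k → 4 ∣ N → f ∈ halfIntModularForms k N χ →
    ∀ (a : ℕ → ℚ), (∀ n : ℕ, qCoeffs f n = ((a n : ℚ) : ℂ)) → (∀ n : ℕ, ‖((a n : ℚ) : ℚ_[ℓ])‖ ≤ 1) →
    ∀ (M β : ℕ), 0 < M →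
      (∀ n : ℕ, n % M = β % M → ‖((a n : ℚ) : ℚ_[ℓ])‖ ≤ ((ℓ : ℝ))⁻¹) →
    ∀ u : ℕ, u.Coprime (M * N) →
      ∀ n : ℕ, n % M = (u ^ 2 * β) % M → ‖((a n : ℚ) : ℚ_[ℓ])‖ ≤ ((ℓ : ℝ))⁻¹

/-- **Raum 2023, Proposition 2.3 (Ramanujan-type congruences with gap: the two RAMIFIED square classes at `p` are coupled;
special case: holomorphic, theta-character, rational `ℓ`-integral coefficients).** Let `ℓ ≠ 2` be a prime,
`f ∈ M_{k/2}(N, χ)` (`k` odd, `4 ∣ N`) with rational `q`-expansion coefficients `a n`, all `ℓ`-integral, and suppose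
`a n ≡ 0 (mod ℓ)` for every `n ≡ β (mod M)`. Let `p` be a prime with `p ∤ ℓN` whose exact power in `M` is `p²`
(`p² ∣ M`, `p³ ∤ M`) and which divides `β` exactly (`p ∣ β`, `p² ∤ β`). Then for EVERY `β'` exactly divisible by `p` with
`β' ≡ β (mod M/p²)`, also `a n ≡ 0 (mod ℓ)` for every `n ≡ β' (mod M)`. Verbatim (arXiv p. 20): «Fix a number field `K ⊂ ℂ`
and a prime ideal `ℓ ⊂ O_K`, `ℓ ∤ 2`. Let `f` be a weakly holomorphic modular form of half-integral weight for a character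
`χχ_θ^r`, `r` odd, with Fourier coefficients `c(f; n) ∈ O_{K,ℓ}`, where `χ` is a Dirichlet character modulo `N`. Assume
that `f` satisfies the Ramanujan-type congruence `∀ n ∈ ℤ: c(f; Mn + β) ≡ 0 (mod ℓ)` for some positive integer `M` and some
integer `β`. Given a prime `p`, we factor `M` as `M_p M_p^#` with a `p`-power `M_p` and `M_p^#` co-prime to `p`. For some
`p ∣ M`, `gcd(p, ℓN) = 1`, assume that `M_p = p²` and that `p` exactly divides `β`. Then for all integers `β'` such that `p`
exactly divides `β'` and `β' ≡ β (mod M_p^#)`, we have `∀ n ∈ ℤ: c(f; Mn + β') ≡ 0 (mod ℓ)`.» No level-raising exception: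
the coupling weight is a Kloosterman sum that is a unit modulo every odd `ℓ` (Lemma 2.4).
[cite: Raum2023RamanujanTypeII, Prop. 2.3 and Lemma 2.4 (arXiv:2105.13170 pp. 20–23)] -/
def prop23_ramanujanCongruence_ramifiedSquareClasses : Prop :=
  ∀ (ℓ : ℕ) [Fact ℓ.Prime], ℓ ≠ 2 →
    ∀ (k N : ℕ) (χ : DirichletCharacter ℂ N) (f : ℍ → ℂ),
    Odd k → 4 ∣ N → f ∈ halfIntModularForms k N χ →
    ∀ (a : ℕ → ℚ), (∀ n : ℕ, qCoeffs f n = ((a n : ℚ) : ℂ)) → (∀ n : ℕ, ‖((a n : ℚ) : ℚ_[ℓ])‖ ≤ 1) →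
    ∀ (M β p : ℕ), p.Prime → ¬ p ∣ ℓ * N → p ^ 2 ∣ M → ¬ p ^ 3 ∣ M → p ∣ β → ¬ p ^ 2 ∣ β →
      (∀ n : ℕ, n % M = β % M → ‖((a n : ℚ) : ℚ_[ℓ])‖ ≤ ((ℓ : ℝ))⁻¹) →
    ∀ β' : ℕ, p ∣ β' → ¬ p ^ 2 ∣ β' → β' % (M / p ^ 2) = β % (M / p ^ 2) →
      ∀ n : ℕ, n % M = β' % M → ‖((a n : ℚ) : ℚ_[ℓ])‖ ≤ ((ℓ : ℝ))⁻¹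

end Literature.NumberTheory.ModularForms.Raum2023

end
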